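import Literature.MathematicalPhysics.QuantumLattice.ProductOperators
import Literature.MathematicalPhysics.QuantumLattice.SpinSystemProofs
import Literature.MathematicalPhysics.QuantumLattice.SpinOperatorsProofs
import Literature.MathematicalPhysics.QuantumLattice.LiebMattisLadder
import HarnessLib

/-!
# Mermin–Wagner for general interactions, I: the imaginary spin gauge and the per-term perturbation

Topic `MathematicalPhysics/QuantumLattice`; first of three sibling PROOF files of
`Literature/MathematicalPhysics/QuantumLattice/HeisenbergOrder.lean` which together DISCHARGE the named
fact `Literature.MathematicalPhysics.QuantumLattice.mermin_wagner_general` (hubbard.S12, general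
interactions): `…MerminWagnerGaugeProofs` (this file) → `…MerminWagnerTorusProofs` →
`…MerminWagnerProofs` (`mermin_wagner_general_holds`). Theorems only: no definition, no named fact,
no statement is introduced or changed (the gauge is a `local notation`).

## The route

The tree states `mermin_wagner_general` for the FINITE-VOLUME torus Gibbs states (`¬ HasTorusLRO` of
`spinSpinCorrTorusOf`). Its docstring cites Klein–Landau–Shucker (1981) (every KMS state in `d ≤ 2` is
invariant) + Koma–Tasaki (1993) (`m_s ≥ σ`) + the Bratteli–Robinson KMS glue, an infinite-volume
route whose formalisation would need the KMS / quasi-local infinite-volume formalism. The SAME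
finite-volume statement has a direct published proof: the McBryan–Spencer complex-rotation
(imaginary gauge) method, extended to quantum systems by Ito (1982) and, in the finite-volume
trace-inequality form used here, by Koma–Tasaki, PRL 68 (1992) 3248, whose note [11] records that it
"applies to quantum spin systems" and proves the power-law bound (4) (and its one-dimensional
analogue) "for a large class of quantum spin systems with short range interaction which is invariant
under the global rotation about the z-axis". We follow that proof (eqs. (5)–(13)) for a general
Hermitian, bounded, finite-range interaction; uniform power-law decay then excludes long-range order
(`not_hasTorusLRO_of_abs_le_rpow`), exactly as in the tree's discharge of `koma_tasaki_noLRO`.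

## Contents of this file (Koma–Tasaki eqs. (5), (7)–(9), (11), transcribed to spins)

* matrix-norm lemmas: `‖single i j c‖ ≤ ‖c‖`, `‖A‖ ≤ Σ_{ij} ‖A_{ij}‖`, `‖A_{ij}‖ ≤ ‖A‖` (L²-operator norm);
* the gauge `W_ψ = diag (σ ↦ e^{-Σ_u ψ_u σ_u})` (local notation `(Matrix.diagonal fun σ : TensorIndex _ (n + 1) =>
      ((Real.exp (-(∑ u, (ψ) u * ((σ u : ℕ) : ℝ))) : ℝ) : ℂ))`): `W_ψ W_{-ψ} = 1`,
  `W_ψ Ŝ^±_x W_ψ⁻¹ = e^{±ψ_x} Ŝ^±_x` (eq. (8)), multiplicativity, locality on `B ⊗ 𝟙`;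
* the perturbation `U = ½(W B W⁻¹ + h.c.) - B` of a Hermitian CHARGE-CONSERVING `B` (commuting with
  `Ŝᶻ_tot`): entrywise `U_{ab} = (cosh (S(a) - S(b)) - 1) B_{ab}` (eq. (9)), charge conservation
  `Σ a_u = Σ b_u` on the support, hence `|S(a) - S(b)| ≤ n |Γ| osc ψ`, and the bound
  `‖U‖ ≤ N² C (cosh (n |Γ| κ) - 1)` (`norm_hermitianPart_gauge_sub_le`, eq. (11) for one term), with its
  local version `norm_hermitianPart_gauge_localOp_sub_le` for `B ⊗ 𝟙_{Λ∖Y}`.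

## Sources

* T. Koma, H. Tasaki, *Decay of superconducting and magnetic correlations in one- and two-dimensional
  Hubbard models*, PRL **68** (1992) 3248 = arXiv:cond-mat/9709068, eqs. (5)–(13) and note [11].
* K. R. Ito, *Clustering in low-dimensional SO(N)-invariant statistical models with long-range
  interactions*, J. Stat. Phys. **29** (1982) 747 (the quantum McBryan–Spencer method).
* O. A. McBryan, T. Spencer, Comm. Math. Phys. **53** (1977) 299.
* A. Klein, L. J. Landau, D. S. Shucker, J. Stat. Phys. **26** (1981) 505 (the infinite-volume theorem
  cited by the fact; not used in the proof).

## Mathlib / tree status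

Used from the tree: `onSite`, `localOp`, `norm_localOp_holds`, `onSite_smul'/add'`, `spinRaise_apply`,
`spinLower_apply`, `LiebMattis.totalSpin_two_eq_diagonal`. From Mathlib: `Matrix.diagonal` algebra,
`Matrix.l2_opNorm_*` (scoped `Matrix.Norms.L2Operator`), `Pi.norm_single`, `Real.cosh_le_cosh`.
-/

noncomputable section

open Matrix Complex Finset
open scoped Matrix.Norms.L2Operator ComplexOrder

namespace Literature.MathematicalPhysics.QuantumLattice.MerminWagner

open Literature.MathematicalPhysics.QuantumLattice

section MatrixNorm

variable {m : Type*} [Fintype m] [DecidableEq m]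

/-- The `L²`-operator norm of a matrix unit is at most the norm of its entry (C⋆-identity:
`‖E‖² = ‖Eᴴ E‖ = ‖diag (single j 1)‖ = 1`). [folklore] -/
theorem l2_opNorm_single_le (i j : m) (c : ℂ) : ‖(Matrix.single i j c : Matrix m m ℂ)‖ ≤ ‖c‖ := by
  have h1 : ‖(Matrix.single i j (1 : ℂ) : Matrix m m ℂ)‖ ≤ 1 := by
    have hsq : ‖(Matrix.single i j (1 : ℂ) : Matrix m m ℂ)‖ *
          ‖(Matrix.single i j (1 : ℂ) : Matrix m m ℂ)‖ = 1 ∨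
        ‖(Matrix.single i j (1 : ℂ) : Matrix m m ℂ)‖ *
          ‖(Matrix.single i j (1 : ℂ) : Matrix m m ℂ)‖ = 0 := by
      rw [← l2_opNorm_conjTranspose_mul_self, conjTranspose_single, star_one,
        single_mul_single_same, one_mul, ← diagonal_single, l2_opNorm_diagonal, Pi.norm_single,
        norm_one]
      exact Or.inl rfl
    rcases hsq with h | h
    · nlinarith [norm_nonneg (Matrix.single i j (1 : ℂ) : Matrix m m ℂ)]
    · rw [mul_self_eq_zero.mp h]
      exact zero_le_one
  have hc : (Matrix.single i j c : Matrix m m ℂ) = c • Matrix.single i j (1 : ℂ) := by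
    rw [smul_single, smul_eq_mul, mul_one]
  rw [hc, norm_smul]
  calc ‖c‖ * ‖(Matrix.single i j (1 : ℂ) : Matrix m m ℂ)‖ ≤ ‖c‖ * 1 :=
        mul_le_mul_of_nonneg_left h1 (norm_nonneg c)
    _ = ‖c‖ := mul_one _

/-- The `L²`-operator norm is bounded by the sum of the norms of the entries. [folklore] -/
theorem l2_opNorm_le_sum_norm_apply (A : Matrix m m ℂ) : ‖A‖ ≤ ∑ i, ∑ j, ‖A i j‖ := by
  conv_lhs => rw [matrix_eq_sum_single A]
  refine (norm_sum_le _ _).trans (Finset.sum_le_sum fun i _ => ?_)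
  refine (norm_sum_le _ _).trans (Finset.sum_le_sum fun j _ => ?_)
  exact l2_opNorm_single_le i j (A i j)

/-- A bound on the `L²`-operator norm of a matrix bounds every entry:
`‖M‖ ≤ C → |M_{ij}| ≤ C` (`M_{ij} = (M e_j)_i`). [folklore] -/
theorem norm_apply_le_of_l2_opNorm_le {M : Matrix m m ℂ} {C : ℝ} (hM : ‖M‖ ≤ C) (i j : m) :
    ‖M i j‖ ≤ C := by
  refine le_trans ?_ hM
  have h := l2_opNorm_mulVec M (EuclideanSpace.single j (1 : ℂ))
  rw [PiLp.norm_single, norm_one, mul_one] at h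
  refine le_trans ?_ h
  have hs : (⇑(EuclideanSpace.single j (1 : ℂ)) : m → ℂ) = Pi.single j 1 :=
    funext fun k => by simp [Pi.single_apply, eq_comm]
  have h2 := PiLp.norm_apply_le
    ((EuclideanSpace.equiv m ℂ).symm (M *ᵥ ⇑(EuclideanSpace.single j (1 : ℂ)))) i
  have h3 : ((EuclideanSpace.equiv m ℂ).symm (M *ᵥ ⇑(EuclideanSpace.single j (1 : ℂ)))) i =
      M i j := by
    rw [hs, mulVec_single_one]
    rfl
  rw [h3] at h2
  exact h2

end MatrixNorm

variable {Λ : Type*} [Fintype Λ] [DecidableEq Λ] {n : ℕ}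


/-- `W_ψ W_{-ψ} = 1` (the gauge is invertible with inverse `W_{-ψ}`). Koma–Tasaki, PRL 68 (1992) 3248,
eq. (5). [cite: KomaTasakiPRL1992, eq. (5)] -/
theorem gauge_mul_gauge_neg (ψ : Λ → ℝ) :
    ((Matrix.diagonal fun σ : TensorIndex _ (n + 1) =>
      ((Real.exp (-(∑ u, (ψ) u * ((σ u : ℕ) : ℝ))) : ℝ) : ℂ)) : Op Λ (n + 1)) * (Matrix.diagonal fun σ : TensorIndex _ (n + 1) =>
      ((Real.exp (-(∑ u, (-ψ) u * ((σ u : ℕ) : ℝ))) : ℝ) : ℂ)) = 1 := by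
  rw [diagonal_mul_diagonal, ← diagonal_one]
  congr 1
  funext σ
  rw [← Complex.ofReal_mul, ← Real.exp_add]
  simp only [Pi.neg_apply, neg_mul, sum_neg_distrib, neg_neg, neg_add_cancel, Real.exp_zero,
    Complex.ofReal_one]

/-- `W_{-ψ} W_ψ = 1`. Koma–Tasaki, PRL 68 (1992) 3248, eq. (5). [cite: KomaTasakiPRL1992, eq. (5)] -/
theorem gauge_neg_mul_gauge (ψ : Λ → ℝ) :
    ((Matrix.diagonal fun σ : TensorIndex _ (n + 1) =>
      ((Real.exp (-(∑ u, (-ψ) u * ((σ u : ℕ) : ℝ))) : ℝ) : ℂ)) : Op Λ (n + 1)) * (Matrix.diagonal fun σ : TensorIndex _ (n + 1) =>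
      ((Real.exp (-(∑ u, (ψ) u * ((σ u : ℕ) : ℝ))) : ℝ) : ℂ)) = 1 := by
  have h := gauge_mul_gauge_neg (n := n) (-ψ)
  rwa [neg_neg] at h

/-- Conjugating a single-site operator by the gauge only involves the weight at that site:
`W_ψ (𝟙 ⊗ a ⊗ 𝟙) W_ψ⁻¹ = 𝟙 ⊗ (w a w⁻¹) ⊗ 𝟙` with `w = diag (e^{-ψ_x k})`. Koma–Tasaki, PRL 68 (1992)
3248, eqs. (5), (8). [folklore] -/
theorem gauge_conj_onSite (ψ : Λ → ℝ) (x : Λ) (a : Matrix (Fin (n + 1)) (Fin (n + 1)) ℂ) :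
    ((Matrix.diagonal fun σ : TensorIndex _ (n + 1) =>
      ((Real.exp (-(∑ u, (ψ) u * ((σ u : ℕ) : ℝ))) : ℝ) : ℂ)) : Op Λ (n + 1)) * onSite x a * (Matrix.diagonal fun σ : TensorIndex _ (n + 1) =>
      ((Real.exp (-(∑ u, (-ψ) u * ((σ u : ℕ) : ℝ))) : ℝ) : ℂ)) =
      onSite x (diagonal (fun k : Fin (n + 1) => ((Real.exp (-(ψ x * ((k : ℕ) : ℝ))) : ℝ) : ℂ)) * a *
        diagonal (fun k : Fin (n + 1) => ((Real.exp (ψ x * ((k : ℕ) : ℝ)) : ℝ) : ℂ))) := by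
  ext σ τ
  rw [mul_diagonal, diagonal_mul, onSite_apply, onSite_apply, mul_diagonal, diagonal_mul]
  split_ifs with h
  · -- off `x` the configurations agree, so the weights cancel except at `x`
    have hsum : -(∑ u, ψ u * ((σ u : ℕ) : ℝ)) + -(∑ u, (-ψ) u * ((τ u : ℕ) : ℝ)) =
        -(ψ x * ((σ x : ℕ) : ℝ)) + ψ x * ((τ x : ℕ) : ℝ) := by
      simp only [Pi.neg_apply, neg_mul, sum_neg_distrib, neg_neg]
      rw [← sub_eq_neg_add, ← sub_eq_neg_add, ← sum_sub_distrib]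
      rw [Finset.sum_eq_single x (fun u _ hu => by rw [h u hu, sub_self]) (fun hx => absurd (mem_univ x) hx)]
    calc _ = ((Real.exp (-(∑ u, ψ u * ((σ u : ℕ) : ℝ))) : ℂ) *
          (Real.exp (-(∑ u, (-ψ) u * ((τ u : ℕ) : ℝ))) : ℂ)) * a (σ x) (τ x) := by ring
      _ = ((Real.exp (-(ψ x * ((σ x : ℕ) : ℝ))) : ℂ) * (Real.exp (ψ x * ((τ x : ℕ) : ℝ)) : ℂ)) *
          a (σ x) (τ x) := by
          rw [← Complex.ofReal_mul, ← Real.exp_add, hsum, Real.exp_add, Complex.ofReal_mul]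
      _ = _ := by ring
  · simp

/-- **The gauge rescales the raising operator**: `W_ψ Ŝ⁺_x W_ψ⁻¹ = e^{ψ_x} Ŝ⁺_x` (Koma–Tasaki's eq. (8)
for the spin raising operator, cf. their magnetic case `S⁺_x = c†_{x↑} c_{x↓}`). Koma–Tasaki, PRL 68
(1992) 3248, eq. (8) and the last paragraph of the proof. [cite: KomaTasakiPRL1992, eq. (8)] -/
theorem gauge_conj_spinRaise (ψ : Λ → ℝ) (x : Λ) :
    ((Matrix.diagonal fun σ : TensorIndex _ (n + 1) =>
      ((Real.exp (-(∑ u, (ψ) u * ((σ u : ℕ) : ℝ))) : ℝ) : ℂ)) : Op Λ (n + 1)) * onSite x (spinRaise n) * (Matrix.diagonal fun σ : TensorIndex _ (n + 1) =>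
      ((Real.exp (-(∑ u, (-ψ) u * ((σ u : ℕ) : ℝ))) : ℝ) : ℂ)) =
      ((Real.exp (ψ x) : ℝ) : ℂ) • onSite x (spinRaise n) := by
  rw [gauge_conj_onSite, ← onSite_smul']
  congr 1
  ext k l
  rw [mul_diagonal, diagonal_mul, Matrix.smul_apply, smul_eq_mul, spinRaise_apply]
  split_ifs with h
  · rw [h]
    push_cast
    rw [mul_comm (cexp _) _, mul_assoc, ← Complex.exp_add, mul_comm]
    congr 2
    ring
  · simp

/-- **The gauge rescales the lowering operator**: `W_ψ Ŝ⁻_x W_ψ⁻¹ = e^{-ψ_x} Ŝ⁻_x`. Koma–Tasaki, PRL 68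
(1992) 3248, eq. (8). [cite: KomaTasakiPRL1992, eq. (8)] -/
theorem gauge_conj_spinLower (ψ : Λ → ℝ) (x : Λ) :
    ((Matrix.diagonal fun σ : TensorIndex _ (n + 1) =>
      ((Real.exp (-(∑ u, (ψ) u * ((σ u : ℕ) : ℝ))) : ℝ) : ℂ)) : Op Λ (n + 1)) * onSite x (spinLower n) * (Matrix.diagonal fun σ : TensorIndex _ (n + 1) =>
      ((Real.exp (-(∑ u, (-ψ) u * ((σ u : ℕ) : ℝ))) : ℝ) : ℂ)) =
      ((Real.exp (-ψ x) : ℝ) : ℂ) • onSite x (spinLower n) := by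
  rw [gauge_conj_onSite, ← onSite_smul']
  congr 1
  ext k l
  rw [mul_diagonal, diagonal_mul, Matrix.smul_apply, smul_eq_mul, spinLower_apply]
  split_ifs with h
  · rw [h]
    push_cast
    rw [mul_comm (cexp _) _, mul_assoc, ← Complex.exp_add, mul_comm]
    congr 2
    ring
  · simp

/-- Gauge eigen-operators multiply: if `W A W⁻¹ = κ A` and `W B W⁻¹ = κ' B` then
`W (A B) W⁻¹ = (κ κ') (A B)`. Koma–Tasaki, PRL 68 (1992) 3248, eq. (8). [folklore] -/
theorem gauge_conj_mul (ψ : Λ → ℝ) {A B : Op Λ (n + 1)} {κ κ' : ℂ}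
    (hA : ((Matrix.diagonal fun σ : TensorIndex _ (n + 1) =>
      ((Real.exp (-(∑ u, (ψ) u * ((σ u : ℕ) : ℝ))) : ℝ) : ℂ)) : Op Λ (n + 1)) * A * (Matrix.diagonal fun σ : TensorIndex _ (n + 1) =>
      ((Real.exp (-(∑ u, (-ψ) u * ((σ u : ℕ) : ℝ))) : ℝ) : ℂ)) = κ • A)
    (hB : ((Matrix.diagonal fun σ : TensorIndex _ (n + 1) =>
      ((Real.exp (-(∑ u, (ψ) u * ((σ u : ℕ) : ℝ))) : ℝ) : ℂ)) : Op Λ (n + 1)) * B * (Matrix.diagonal fun σ : TensorIndex _ (n + 1) =>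
      ((Real.exp (-(∑ u, (-ψ) u * ((σ u : ℕ) : ℝ))) : ℝ) : ℂ)) = κ' • B) :
    ((Matrix.diagonal fun σ : TensorIndex _ (n + 1) =>
      ((Real.exp (-(∑ u, (ψ) u * ((σ u : ℕ) : ℝ))) : ℝ) : ℂ)) : Op Λ (n + 1)) * (A * B) * (Matrix.diagonal fun σ : TensorIndex _ (n + 1) =>
      ((Real.exp (-(∑ u, (-ψ) u * ((σ u : ℕ) : ℝ))) : ℝ) : ℂ)) = (κ * κ') • (A * B) := by
  set W : Op Λ (n + 1) := (Matrix.diagonal fun σ : TensorIndex _ (n + 1) =>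
      ((Real.exp (-(∑ u, (ψ) u * ((σ u : ℕ) : ℝ))) : ℝ) : ℂ)) with hW
  set W' : Op Λ (n + 1) := (Matrix.diagonal fun σ : TensorIndex _ (n + 1) =>
      ((Real.exp (-(∑ u, (-ψ) u * ((σ u : ℕ) : ℝ))) : ℝ) : ℂ)) with hW'
  have h2 : W' * W = 1 := gauge_neg_mul_gauge ψ
  calc W * (A * B) * W' = W * A * (W' * W) * B * W' := by rw [h2]; noncomm_ring
    _ = (W * A * W') * (W * B * W') := by noncomm_ring
    _ = (κ * κ') • (A * B) := by rw [hA, hB, smul_mul_smul_comm]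

/-- **The gauge acts locally on local operators**: `W_ψ (B ⊗ 𝟙_{Λ∖Y}) W_ψ⁻¹ = (W^Y_ψ B (W^Y_ψ)⁻¹) ⊗ 𝟙`
with `W^Y_ψ` the gauge of the region `Y` (the weights off `Y` cancel). Bratteli–Robinson II §6.2.1
(product structure). [folklore] -/
theorem gauge_conj_localOp (ψ : Λ → ℝ) (Y : Finset Λ)
    (B : Matrix (↥Y → Fin (n + 1)) (↥Y → Fin (n + 1)) ℂ) :
    ((Matrix.diagonal fun σ : TensorIndex _ (n + 1) =>
      ((Real.exp (-(∑ u, (ψ) u * ((σ u : ℕ) : ℝ))) : ℝ) : ℂ)) : Op Λ (n + 1)) * localOp Y B * (Matrix.diagonal fun σ : TensorIndex _ (n + 1) =>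
      ((Real.exp (-(∑ u, (-ψ) u * ((σ u : ℕ) : ℝ))) : ℝ) : ℂ)) =
      localOp Y (((Matrix.diagonal fun σ : TensorIndex _ (n + 1) =>
      ((Real.exp (-(∑ u, (fun u : ↥Y => ψ u) u * ((σ u : ℕ) : ℝ))) : ℝ) : ℂ)) : Op ↥Y (n + 1)) * B * (Matrix.diagonal fun σ : TensorIndex _ (n + 1) =>
      ((Real.exp (-(∑ u, (-fun u : ↥Y => ψ u) u * ((σ u : ℕ) : ℝ))) : ℝ) : ℂ))) := by
  ext σ τ
  rw [mul_diagonal, diagonal_mul, localOp_apply, localOp_apply, mul_diagonal, diagonal_mul]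
  split_ifs with h
  · have hsum : -(∑ u, ψ u * ((σ u : ℕ) : ℝ)) + -(∑ u, (-ψ) u * ((τ u : ℕ) : ℝ)) =
        -(∑ u : ↥Y, ψ u * (((σ u : Fin (n + 1)) : ℕ) : ℝ)) +
          -(∑ u : ↥Y, (-fun v : ↥Y => ψ v) u * (((τ u : Fin (n + 1)) : ℕ) : ℝ)) := by
      simp only [Pi.neg_apply, neg_mul, sum_neg_distrib, neg_neg]
      rw [← sub_eq_neg_add, ← sub_eq_neg_add, ← sum_sub_distrib, ← sum_sub_distrib]
      have hc : ∑ u : ↥Y, (ψ u * (((τ u : Fin (n + 1)) : ℕ) : ℝ) -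
          ψ u * (((σ u : Fin (n + 1)) : ℕ) : ℝ)) =
          ∑ u ∈ Y, (ψ u * ((τ u : ℕ) : ℝ) - ψ u * ((σ u : ℕ) : ℝ)) :=
        Finset.sum_coe_sort Y (fun u => ψ u * ((τ u : ℕ) : ℝ) - ψ u * ((σ u : ℕ) : ℝ))
      rw [hc]
      exact (Finset.sum_subset (subset_univ Y) fun u _ hu => by rw [h u hu, sub_self]).symm
    calc _ = ((Real.exp (-(∑ u, ψ u * ((σ u : ℕ) : ℝ))) : ℂ) *
          (Real.exp (-(∑ u, (-ψ) u * ((τ u : ℕ) : ℝ))) : ℂ)) * B (fun u => σ u) (fun u => τ u) := by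
          ring
      _ = ((Real.exp (-(∑ u : ↥Y, ψ u * (((σ u : Fin (n + 1)) : ℕ) : ℝ))) : ℂ) *
          (Real.exp (-(∑ u : ↥Y, (-fun v : ↥Y => ψ v) u * (((τ u : Fin (n + 1)) : ℕ) : ℝ))) : ℂ)) *
          B (fun u => σ u) (fun u => τ u) := by
          rw [← Complex.ofReal_mul, ← Real.exp_add, hsum, Real.exp_add, Complex.ofReal_mul]
      _ = _ := by ring
  · simp


/-! ### The Hermitian part of a gauge-conjugated charge-conserving operator -/

section Region

variable {Γ : Type*} [Fintype Γ] [DecidableEq Γ]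

/-- Entries of a gauge-conjugated operator: `(W B W⁻¹)_{ab} = e^{S(b) - S(a)} B_{ab}` with
`S(a) = Σ_u ψ_u a_u`. Koma–Tasaki, PRL 68 (1992) 3248, eq. (7). [folklore] -/
theorem gauge_conj_apply (ψ : Γ → ℝ) (B : Op Γ (n + 1)) (a b : TensorIndex Γ (n + 1)) :
    (((Matrix.diagonal fun σ : TensorIndex _ (n + 1) =>
      ((Real.exp (-(∑ u, (ψ) u * ((σ u : ℕ) : ℝ))) : ℝ) : ℂ)) : Op Γ (n + 1)) * B * (Matrix.diagonal fun σ : TensorIndex _ (n + 1) =>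
      ((Real.exp (-(∑ u, (-ψ) u * ((σ u : ℕ) : ℝ))) : ℝ) : ℂ))) a b =
      ((Real.exp ((∑ u, ψ u * ((b u : ℕ) : ℝ)) - ∑ u, ψ u * ((a u : ℕ) : ℝ)) : ℝ) : ℂ) * B a b := by
  rw [mul_diagonal, diagonal_mul]
  simp only [Pi.neg_apply, neg_mul, sum_neg_distrib, neg_neg]
  rw [mul_comm _ (B a b), mul_assoc, ← Complex.ofReal_mul, ← Real.exp_add, mul_comm]
  congr 3
  ring

omit [DecidableEq Γ] in
/-- The gauge is a real diagonal matrix, hence Hermitian. [folklore] -/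
theorem conjTranspose_gauge (ψ : Γ → ℝ) : (((Matrix.diagonal fun σ : TensorIndex _ (n + 1) =>
      ((Real.exp (-(∑ u, (ψ) u * ((σ u : ℕ) : ℝ))) : ℝ) : ℂ)) : Op Γ (n + 1)))ᴴ = (Matrix.diagonal fun σ : TensorIndex _ (n + 1) =>
      ((Real.exp (-(∑ u, (ψ) u * ((σ u : ℕ) : ℝ))) : ℝ) : ℂ)) := by
  rw [diagonal_conjTranspose]
  congr 1
  funext σ
  exact Complex.conj_ofReal _

/-- Entries of the perturbation `U = ½(W B W⁻¹ + (W B W⁻¹)ᴴ) - B` for Hermitian `B`: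
`U_{ab} = (cosh (S(a) - S(b)) - 1) B_{ab}` (the Hermitian part of `W B W⁻¹ - B = U + iP`).
Koma–Tasaki, PRL 68 (1992) 3248, eqs. (7), (9). [cite: KomaTasakiPRL1992, eqs. (7) and (9)] -/
theorem hermitianPart_gauge_sub_apply (ψ : Γ → ℝ) {B : Op Γ (n + 1)} (hB : B.IsHermitian)
    (a b : TensorIndex Γ (n + 1)) :
    ((2 : ℂ)⁻¹ • (((Matrix.diagonal fun σ : TensorIndex _ (n + 1) =>
      ((Real.exp (-(∑ u, (ψ) u * ((σ u : ℕ) : ℝ))) : ℝ) : ℂ)) : Op Γ (n + 1)) * B * (Matrix.diagonal fun σ : TensorIndex _ (n + 1) =>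
      ((Real.exp (-(∑ u, (-ψ) u * ((σ u : ℕ) : ℝ))) : ℝ) : ℂ)) + (((Matrix.diagonal fun σ : TensorIndex _ (n + 1) =>
      ((Real.exp (-(∑ u, (ψ) u * ((σ u : ℕ) : ℝ))) : ℝ) : ℂ)) : Op Γ (n + 1)) * B * (Matrix.diagonal fun σ : TensorIndex _ (n + 1) =>
      ((Real.exp (-(∑ u, (-ψ) u * ((σ u : ℕ) : ℝ))) : ℝ) : ℂ)))ᴴ) - B)
        a b =
      ((Real.cosh ((∑ u, ψ u * ((a u : ℕ) : ℝ)) - ∑ u, ψ u * ((b u : ℕ) : ℝ)) - 1 : ℝ) : ℂ) * B a b := by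
  have hT : (((Matrix.diagonal fun σ : TensorIndex _ (n + 1) =>
      ((Real.exp (-(∑ u, (ψ) u * ((σ u : ℕ) : ℝ))) : ℝ) : ℂ)) : Op Γ (n + 1)) * B * (Matrix.diagonal fun σ : TensorIndex _ (n + 1) =>
      ((Real.exp (-(∑ u, (-ψ) u * ((σ u : ℕ) : ℝ))) : ℝ) : ℂ)))ᴴ = ((Matrix.diagonal fun σ : TensorIndex _ (n + 1) =>
      ((Real.exp (-(∑ u, (-ψ) u * ((σ u : ℕ) : ℝ))) : ℝ) : ℂ)) : Op Γ (n + 1)) * B * (Matrix.diagonal fun σ : TensorIndex _ (n + 1) =>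
      ((Real.exp (-(∑ u, (-(-ψ)) u * ((σ u : ℕ) : ℝ))) : ℝ) : ℂ)) := by
    rw [conjTranspose_mul, conjTranspose_mul, hB.eq, conjTranspose_gauge, conjTranspose_gauge, neg_neg,
      Matrix.mul_assoc]
  rw [hT, Matrix.sub_apply, Matrix.smul_apply, Matrix.add_apply, gauge_conj_apply, gauge_conj_apply,
    smul_eq_mul]
  simp only [Pi.neg_apply, neg_mul, sum_neg_distrib]
  rw [Real.cosh_eq]
  push_cast
  ring

/-- **Charge conservation**: an operator commuting with `Ŝᶻ_tot` has nonzero entries only between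
configurations of equal weight `Σ_u σ_u`. [folklore] -/
theorem sum_eq_sum_of_commute_totalSpin_of_apply_ne_zero {B : Op Γ (n + 1)}
    (hBc : Commute B (totalSpin (Λ := Γ) n 2)) {a b : TensorIndex Γ (n + 1)} (hab : B a b ≠ 0) :
    ∑ u, ((a u : ℕ) : ℝ) = ∑ u, ((b u : ℕ) : ℝ) := by
  have h := congrFun (congrFun hBc.eq a) b
  rw [LiebMattis.totalSpin_two_eq_diagonal, mul_diagonal, diagonal_mul] at h
  have h2 : (∑ x, ((n : ℂ) / 2 - ((b x : ℕ) : ℂ))) = ∑ x, ((n : ℂ) / 2 - ((a x : ℕ) : ℂ)) :=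
    mul_left_cancel₀ hab (by rw [h, mul_comm])
  rw [sum_sub_distrib, sum_sub_distrib, sub_right_inj] at h2
  have h3 : ((∑ u, ((a u : ℕ) : ℝ) : ℝ) : ℂ) = ((∑ u, ((b u : ℕ) : ℝ) : ℝ) : ℂ) := by
    push_cast
    exact h2.symm
  exact_mod_cast h3

omit [DecidableEq Γ] in
/-- The gauge exponent difference between two configurations of equal weight is controlled by the
oscillation of `ψ`: `|S(a) - S(b)| ≤ n |Γ| κ`. [folklore] -/
theorem abs_sum_sub_sum_le (ψ : Γ → ℝ) {κ : ℝ} (hκ : ∀ u v, |ψ u - ψ v| ≤ κ)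
    {a b : TensorIndex Γ (n + 1)} (hab : ∑ u, ((a u : ℕ) : ℝ) = ∑ u, ((b u : ℕ) : ℝ)) :
    |(∑ u, ψ u * ((a u : ℕ) : ℝ)) - ∑ u, ψ u * ((b u : ℕ) : ℝ)| ≤ n * Fintype.card Γ * κ := by
  cases isEmpty_or_nonempty Γ with
  | inl hΓ => simp
  | inr hΓ =>
    obtain ⟨u₀⟩ := hΓ
    have hκ0 : 0 ≤ κ := (abs_nonneg _).trans (hκ u₀ u₀)
    have key : (∑ u, ψ u * ((a u : ℕ) : ℝ)) - ∑ u, ψ u * ((b u : ℕ) : ℝ) =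
        ∑ u, (ψ u - ψ u₀) * (((a u : ℕ) : ℝ) - ((b u : ℕ) : ℝ)) := by
      have h0 : ∑ u, (((a u : ℕ) : ℝ) - ((b u : ℕ) : ℝ)) = 0 := by
        rw [sum_sub_distrib, hab, sub_self]
      calc (∑ u, ψ u * ((a u : ℕ) : ℝ)) - ∑ u, ψ u * ((b u : ℕ) : ℝ)
          = ∑ u, (ψ u - ψ u₀) * (((a u : ℕ) : ℝ) - ((b u : ℕ) : ℝ)) +
              ψ u₀ * ∑ u, (((a u : ℕ) : ℝ) - ((b u : ℕ) : ℝ)) := by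
            rw [mul_sum, ← sum_add_distrib, ← sum_sub_distrib]
            refine sum_congr rfl fun u _ => ?_
            ring
        _ = _ := by rw [h0, mul_zero, add_zero]
    rw [key]
    calc |∑ u, (ψ u - ψ u₀) * (((a u : ℕ) : ℝ) - ((b u : ℕ) : ℝ))|
        ≤ ∑ u, |(ψ u - ψ u₀) * (((a u : ℕ) : ℝ) - ((b u : ℕ) : ℝ))| := abs_sum_le_sum_abs _ _
      _ ≤ ∑ _u : Γ, κ * n := by
          refine sum_le_sum fun u _ => ?_
          rw [abs_mul]
          refine mul_le_mul (hκ u u₀) ?_ (abs_nonneg _) hκ0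
          have ha : ((a u : ℕ) : ℝ) ≤ n := by exact_mod_cast Nat.lt_succ_iff.mp (a u).isLt
          have hb : ((b u : ℕ) : ℝ) ≤ n := by exact_mod_cast Nat.lt_succ_iff.mp (b u).isLt
          have ha0 : (0 : ℝ) ≤ ((a u : ℕ) : ℝ) := by positivity
          have hb0 : (0 : ℝ) ≤ ((b u : ℕ) : ℝ) := by positivity
          rw [abs_le]
          constructor <;> linarith
      _ = n * Fintype.card Γ * κ := by
          rw [sum_const, card_univ, nsmul_eq_mul]
          ring

/-- **Per-term bound on the Koma–Tasaki perturbation** (eqs. (7), (9), (11) for a general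
charge-conserving term): for a Hermitian `B` commuting with `Ŝᶻ_tot`, with entries bounded by `C`,
and a gauge function `ψ` of oscillation `≤ κ`,
`‖½(W B W⁻¹ + (W B W⁻¹)ᴴ) - B‖ ≤ N² C (cosh (n |Γ| κ) - 1)`, `N = (n+1)^{|Γ|}`. Koma–Tasaki, PRL 68 (1992) 3248, eqs. (7), (9), (11) and note [11].
[cite: KomaTasakiPRL1992, eqs. (7), (9), (11)] -/
theorem norm_hermitianPart_gauge_sub_le (ψ : Γ → ℝ) {B : Op Γ (n + 1)} (hB : B.IsHermitian)
    (hBc : Commute B (totalSpin (Λ := Γ) n 2)) {C κ : ℝ} (hC : ∀ a b, ‖B a b‖ ≤ C)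
    (hκ : ∀ u v, |ψ u - ψ v| ≤ κ) :
    ‖(2 : ℂ)⁻¹ • (((Matrix.diagonal fun σ : TensorIndex _ (n + 1) =>
      ((Real.exp (-(∑ u, (ψ) u * ((σ u : ℕ) : ℝ))) : ℝ) : ℂ)) : Op Γ (n + 1)) * B * (Matrix.diagonal fun σ : TensorIndex _ (n + 1) =>
      ((Real.exp (-(∑ u, (-ψ) u * ((σ u : ℕ) : ℝ))) : ℝ) : ℂ)) + (((Matrix.diagonal fun σ : TensorIndex _ (n + 1) =>
      ((Real.exp (-(∑ u, (ψ) u * ((σ u : ℕ) : ℝ))) : ℝ) : ℂ)) : Op Γ (n + 1)) * B * (Matrix.diagonal fun σ : TensorIndex _ (n + 1) =>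
      ((Real.exp (-(∑ u, (-ψ) u * ((σ u : ℕ) : ℝ))) : ℝ) : ℂ)))ᴴ) - B‖ ≤
      (Fintype.card (TensorIndex Γ (n + 1)) : ℝ) ^ 2 * C *
        (Real.cosh (n * Fintype.card Γ * κ) - 1) := by
  have hC0 : 0 ≤ C := (norm_nonneg _).trans (hC (fun _ => 0) (fun _ => 0))
  set δ : ℝ := n * Fintype.card Γ * κ with hδ
  have hcosh1 : 0 ≤ Real.cosh δ - 1 := by linarith [Real.one_le_cosh δ]
  have hentry : ∀ a b : TensorIndex Γ (n + 1),
      ‖((2 : ℂ)⁻¹ • (((Matrix.diagonal fun σ : TensorIndex _ (n + 1) =>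
      ((Real.exp (-(∑ u, (ψ) u * ((σ u : ℕ) : ℝ))) : ℝ) : ℂ)) : Op Γ (n + 1)) * B * (Matrix.diagonal fun σ : TensorIndex _ (n + 1) =>
      ((Real.exp (-(∑ u, (-ψ) u * ((σ u : ℕ) : ℝ))) : ℝ) : ℂ)) +
        (((Matrix.diagonal fun σ : TensorIndex _ (n + 1) =>
      ((Real.exp (-(∑ u, (ψ) u * ((σ u : ℕ) : ℝ))) : ℝ) : ℂ)) : Op Γ (n + 1)) * B * (Matrix.diagonal fun σ : TensorIndex _ (n + 1) =>
      ((Real.exp (-(∑ u, (-ψ) u * ((σ u : ℕ) : ℝ))) : ℝ) : ℂ)))ᴴ) - B) a b‖ ≤ (Real.cosh δ - 1) * C := by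
    intro a b
    rw [hermitianPart_gauge_sub_apply ψ hB, norm_mul, Complex.norm_real, Real.norm_eq_abs]
    by_cases hab : B a b = 0
    · rw [hab, norm_zero, mul_zero]
      exact mul_nonneg hcosh1 hC0
    · have hw := sum_eq_sum_of_commute_totalSpin_of_apply_ne_zero hBc hab
      have hS := abs_sum_sub_sum_le ψ hκ hw
      have hcosh : Real.cosh ((∑ u, ψ u * ((a u : ℕ) : ℝ)) - ∑ u, ψ u * ((b u : ℕ) : ℝ)) ≤
          Real.cosh δ := by
        rw [Real.cosh_le_cosh]
        exact hS.trans (le_abs_self δ)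
      rw [abs_of_nonneg (by linarith [Real.one_le_cosh ((∑ u, ψ u * ((a u : ℕ) : ℝ)) -
        ∑ u, ψ u * ((b u : ℕ) : ℝ))])]
      exact mul_le_mul (by linarith) (hC a b) (norm_nonneg _) hcosh1
  calc _ ≤ ∑ a, ∑ b, ‖((2 : ℂ)⁻¹ • (((Matrix.diagonal fun σ : TensorIndex _ (n + 1) =>
      ((Real.exp (-(∑ u, (ψ) u * ((σ u : ℕ) : ℝ))) : ℝ) : ℂ)) : Op Γ (n + 1)) * B * (Matrix.diagonal fun σ : TensorIndex _ (n + 1) =>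
      ((Real.exp (-(∑ u, (-ψ) u * ((σ u : ℕ) : ℝ))) : ℝ) : ℂ)) +
        (((Matrix.diagonal fun σ : TensorIndex _ (n + 1) =>
      ((Real.exp (-(∑ u, (ψ) u * ((σ u : ℕ) : ℝ))) : ℝ) : ℂ)) : Op Γ (n + 1)) * B * (Matrix.diagonal fun σ : TensorIndex _ (n + 1) =>
      ((Real.exp (-(∑ u, (-ψ) u * ((σ u : ℕ) : ℝ))) : ℝ) : ℂ)))ᴴ) - B) a b‖ := l2_opNorm_le_sum_norm_apply _
    _ ≤ ∑ _a : TensorIndex Γ (n + 1), ∑ _b : TensorIndex Γ (n + 1), (Real.cosh δ - 1) * C :=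
        sum_le_sum fun a _ => sum_le_sum fun b _ => hentry a b
    _ = _ := by
        rw [sum_const, sum_const, card_univ, smul_smul, nsmul_eq_mul]
        push_cast
        ring

end Region


/-- The local version on a region `Y ⊆ Λ`: for `T = B ⊗ 𝟙_{Λ∖Y}` with `B` Hermitian, commuting with
`Ŝᶻ_tot(Y)`, entries bounded by `C`, and `ψ` of oscillation `≤ κ` on `Y`,
`‖½(W T W⁻¹ + (W T W⁻¹)ᴴ) - T‖ ≤ ((n+1)^{|Y|})² C (cosh (n |Y| κ) - 1)`. 
Koma–Tasaki, PRL 68 (1992) 3248, eqs. (7), (9), (11). [cite: KomaTasakiPRL1992, eqs. (7), (9), (11)] -/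
theorem norm_hermitianPart_gauge_localOp_sub_le (ψ : Λ → ℝ) (Y : Finset Λ) {B : Op ↥Y (n + 1)}
    (hB : B.IsHermitian) (hBc : Commute B (totalSpin (Λ := ↥Y) n 2)) {C κ : ℝ}
    (hC : ∀ a b, ‖B a b‖ ≤ C) (hκ : ∀ u ∈ Y, ∀ v ∈ Y, |ψ u - ψ v| ≤ κ) :
    ‖(2 : ℂ)⁻¹ • (((Matrix.diagonal fun σ : TensorIndex _ (n + 1) =>
      ((Real.exp (-(∑ u, (ψ) u * ((σ u : ℕ) : ℝ))) : ℝ) : ℂ)) : Op Λ (n + 1)) * localOp Y B * (Matrix.diagonal fun σ : TensorIndex _ (n + 1) =>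
      ((Real.exp (-(∑ u, (-ψ) u * ((σ u : ℕ) : ℝ))) : ℝ) : ℂ)) +
        (((Matrix.diagonal fun σ : TensorIndex _ (n + 1) =>
      ((Real.exp (-(∑ u, (ψ) u * ((σ u : ℕ) : ℝ))) : ℝ) : ℂ)) : Op Λ (n + 1)) * localOp Y B * (Matrix.diagonal fun σ : TensorIndex _ (n + 1) =>
      ((Real.exp (-(∑ u, (-ψ) u * ((σ u : ℕ) : ℝ))) : ℝ) : ℂ)))ᴴ) - localOp Y B‖ ≤
      ((n + 1 : ℝ) ^ Y.card) ^ 2 * C * (Real.cosh (n * Y.card * κ) - 1) := by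
  have hsub : ∀ M N : Op ↥Y (n + 1), localOp Y (M - N) = localOp Y M - localOp Y N := by
    intro M N
    rw [sub_eq_add_neg, localOp_add, ← neg_one_smul ℂ N, localOp_smul, neg_one_smul, ← sub_eq_add_neg]
  rw [gauge_conj_localOp, ← localOp_conjTranspose, ← localOp_add, ← localOp_smul, ← hsub,
    norm_localOp_holds Y]
  have h := norm_hermitianPart_gauge_sub_le (fun u : ↥Y => ψ u) hB hBc hC (fun u v => hκ u u.2 v v.2)
  have hcard : (Fintype.card (TensorIndex ↥Y (n + 1)) : ℝ) = (n + 1 : ℝ) ^ Y.card := by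
    rw [Fintype.card_fun, Fintype.card_fin, Fintype.card_coe]
    push_cast
    ring
  rw [hcard, Fintype.card_coe] at h
  exact h


end Literature.MathematicalPhysics.QuantumLattice.MerminWagner
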